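import Mathlib
import Summits.MatrixMultiplication.MatrixMultiplication.Theses.ThinBlockAlpha
import Summits.MatrixMultiplication.MatrixMultiplication.Theses.GroupTheoreticSTPP
import Summits.MatrixMultiplication.MatrixMultiplication.Theorems.ThinPackings.Negative.ThinPackingsIffCThesis
import Summits.MatrixMultiplication.MatrixMultiplication.Theorems.ThinBlockAlphaThinPackingsStubPackingToCThesis
import Literature.Computability.AlgebraicComplexity.PrattTrapezoidValSDPP

set_option linter.dupNamespace false

/-!
# Line `two-families-salem-spencer` — skeleton for crux `ThinBlockAlpha.ThinPackings`
(stmt-MatrixMultiplication-10595, route ThinBlockAlpha)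

crux-strategist (planner-cstrat-stmt-MatrixMultiplication-10595-0, 2026-08-16), lens: TRANSFER /
REDUCTION TO A SIMPLER, ALREADY-STAFFED OBJECT.  Line card: `Lines/two-families-salem-spencer.md`.

THE LINE (Cohn–Kleinberg–Szegedy–Umans 2005, arXiv:math/0511460, §4 "simultaneous double product
property" + §6.2 "Triangle-free sets", p. 11 of the held text).  A TWO-FAMILIES design is `n` pairs
`(A i, B i)` of subsets of a finite abelian group `H` with the simultaneous DOUBLE product property
(tree `Literature.…​.IsSDPP`, CKSU Def. 4.1: each `A i + B i` injective, and
`(a − a') + (b − b') = 0` with `a ∈ A i, a' ∈ A j, b ∈ B j, b' ∈ B k` forces `i = k`).  CKSU's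
TRIANGLE LIFT turns it into triples in the ABELIAN group `H³` indexed by `v = (v₁,v₂,v₃)`,
`Â_v = A v₁ × {0} × B v₃`, `B̂_v = B v₁ × A v₂ × {0}`, `Ĉ_v = {0} × B v₂ × A v₃`: the SDPP yields,
from any STPP relation, the index equalities `u₁ = w₁, v₂ = u₂, w₃ = v₃` (one per coordinate of
`H³`), so over a TRIANGLE-FREE (= CORNER-FREE) index set (Salem–Spencer inside `Δ_n`, size `n^{2−o(1)}`,
Behrend) the lift is a genuine STPP family — all of this is PROVED IN THE TREE
(`Literature.Computability.AlgebraicComplexity.addSimultaneousTPP_of_sdpp`,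
`exists_cornerFree_indexMaps_card_ge`, file `PrattTrapezoidValSDPP.lean`).  With the parameters of
CKSU Conjecture 4.7 (= the tree constant `GroupTheoreticSTPP.CPackingConstruction`, item
stmt-MatrixMultiplication-0595, ⟺ `FourierTwoFamiliesModP.PrimeTwoFamilies`, stmt-14308, by the
PROVED support `CyclicReduction`): `|H| ≤ n^{2+δ}`, `|A i||B i| ≥ n^{2−δ}`, the lift has
`n^{2−o(1)}` blocks of volume `∏_t |A_{v_t}||B_{v_t}| ≥ n^{6−3δ}` in a host of order `≤ n^{6+3δ}`,
so `Σ vol^{(2+ε)/3} > |H³|` for `δ ≪ ε`: that is `CThesis` (X_C, stmt-0593) — stub_packingToCThesis,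
provable now (a sorry-free candidate `Glue0595.lean` is attached as evidence on stmt-0595 by
refuter-rreview1-…-f87adc36-0, 2026-08-15) — and `CThesis → ThinPackings` is the landed costume
theorem `Negative/ThinPackingsIffCThesis.not_thinPackings_iff_not_cThesis` (square blocks qualify for
every shape exponent `a`; the symmetrised-cube/type-class uniformisation is inside that proof).  So:

  CKSU Conj 4.7 (two families)  ⟹  X_C  ⟹  ThinPackings     (`ThinPackings_of`, kernel-checked).

A direct assembly with explicit witnesses (uniformise the pairs to `|A i| = P`, `|B i| = Q` by dyadic
pigeonhole + `IsSDPP.mono/reindex`; lift; square blocks `⟨PQ, PQ, PQ⟩`, `L ≥ n^{2−θ}/64`, slack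
`N^η` as soon as `6θ + θη ≤ 2η`) was also kernel-checked by this seat (session file, rc 0) and is
described in the line card; the registered composition goes through `CThesis` to reuse the tree.

WHY THIS IS A DIFFERENT AND EASIER-TO-ATTACK OBJECT (not a costume).  Two legs and a FOUR-term
condition instead of three legs and a six-term condition; the third leg and the simultaneity across
blocks are MANUFACTURED by `Δ_n` + Salem–Spencer.  The lead's stuck point on the frame lines (every
known frame family is sum-injective and sits on the diagonal `η = a`; K1 ⟺ VOLUME EXCESS, conjectured
impossible for frames) does not arise: in an SDPP design the diagonal difference sets `B i − A i` MAY
ALL COINCIDE (CKSU's trivial example) — only diagonal-vs-off-diagonal disjointness is asked — and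
`Σ|A i||B i| ≈ n³ ≫ |H| ≈ n²` is excess by design.  `ThinPackings → CPackingConstruction` is NOT known
(no inverse theorem): the heart is a genuinely different, published, 20-year-old conjecture, outside
BCCGNSU Thm B (arXiv:1605.06702 p. 6: "need not have bounded exponent").

STAFFING CAVEAT (for the continuation lead).  The heart is ALREADY STAFFED on this summit: item
stmt-0595 (GroupTheoreticSTPP, crux r2) and stmt-14308 `PrimeTwoFamilies` (target of route
FourierTwoFamiliesModP, whose disprover lane runs an L²-Fourier kill engine: PrimeCyclicPowerGain /
PrimeDensityDecay, crux folders `Cruxes/PrimeTwoFamilies`, `Cruxes/PrimeCyclicPowerGain`,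
`Cruxes/PrimeDensityDecay`).  Do NOT open a second construction effort here: pick this line only to
LAND `stub_packingToCThesis` (one stub-worker, candidate proof exists), after which the gate closes
this crux by modus ponens the day stmt-0595 / stmt-14308 closes `proved` — and a `refuted` there kills
this line (not the crux).

Registered stubs — rev 2 (lead a2, prover-line-stmt-MatrixMultiplication-10595-a2-0, 2026-08-16):
ONE open stub, `stub_twoFamilies` (= `CPackingConstruction` verbatim, the HEART, XL/open; shared item
stmt-0595).  The former tool stub `stub_packingToCThesis : CPackingConstruction → CThesis` is LANDED
(lead a1, p112559, `Theorems/ThinBlockAlphaThinPackingsStubPackingToCThesis.lean`, decl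
`Summit.MatrixMultiplication.MatrixMultiplication.Theorems.ThinPackings.stub_packingToCThesis`) and is
now used BY NAME inside the composition: `ThinPackings_of : Stmt.stub_twoFamilies → ThinPackings` is
PROVED below (no sorry) and `ThinPackings_proof` applies it to the one registered (sorried) stub.  The
crux therefore closes by modus ponens the day stmt-0595 (⟺ stmt-14308) closes `proved`; it is
EQUIVALENT to stmt-0593 `CThesis` (p76748), and is refuted iff stmt-0596 `CAbelianObstructionNeg` is
proved.

Disproof.lean (cdisprove cycles 1–3, read 2026-08-16T15:10Z) honoured: no `_false_without_` theorem
exists; §7 costume theorem is USED (its `←` direction is the last step), and the witnesses it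
produces are SQUARE near-tight families, which §7 declares load-bearing-equivalent; §3b refuted
strengthenings: the lift has `η > 0`, `L → ∞`, `N → ∞` and UNBOUNDED EXPONENT (a bounded-exponent
two-families design cannot reach `α = β = 2`: Thm B applied to its lift — consistent with
`not_thinPackingsBoundedExponent`); §8 host cap idem.  No stub is an instance of a landed Negative
lemma (`Theorems/ThinPackings/Negative/*`); `ledger negatives` (6 entries) has nothing on SDPP.
-/

namespace Summit.MatrixMultiplication.MatrixMultiplication.Cruxes.ThinPackings.TwoFamiliesSalemSpencer

open Summit.MatrixMultiplication.MatrixMultiplication.Theses.GroupTheoreticSTPP (CPackingConstruction CThesis)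
open Summit.MatrixMultiplication.MatrixMultiplication.Theses.ThinBlockAlpha (ThinPackings)
open Summit.MatrixMultiplication.MatrixMultiplication.Theorems.ThinPackings.Negative
  (not_thinPackings_iff_not_cThesis)

/-! ## Statement of the open stub as a named `Prop` (`Stmt.stub_twoFamilies`)

Single source for the composition `ThinPackings_of` (hypothesis admissible by name: head constant's last
component = the registered stub name); the REGISTERED stub `stub_twoFamilies` below restates it verbatim as
a sorried theorem, and `ThinPackings_proof` type-checks only if the two copies agree definitionally. -/
namespace Stmt

/-- Statement of `stub_twoFamilies`: CKSU Conjecture 4.7, verbatim the tree's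
`GroupTheoreticSTPP.CPackingConstruction` (item stmt-MatrixMultiplication-0595). -/
def stub_twoFamilies : Prop := CPackingConstruction

end Stmt

/-! ## Stub 1 (HEART, XL/open — hardest): CKSU Conjecture 4.7 "two families"

For every `δ > 0` and `n₀` there are `n ≥ n₀` pairs `(A i, B i)` in a finite abelian group `H` with
the simultaneous double product property, `|H| ≤ n^{2+δ}` and `|A i||B i| ≥ n^{2−δ}` — verbatim the
tree constant `GroupTheoreticSTPP.CPackingConstruction` (shared item stmt-MatrixMultiplication-0595;
equivalent to `FourierTwoFamiliesModP.PrimeTwoFamilies`, stmt-14308, by the proved `CyclicReduction`).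
Why it might fail: open since 2005 with no candidate near `α = β = 2`: the best SDPP family (CKSU
Prop. 4.5, `Cyc_m^{2ℓ}`, `α = log₂(m−1) < β = log₂ m`) has bounded exponent, where BCCGNSU Thm B
(applied to the triangle lift) forbids success, so witnesses need exponent → ∞; in cyclic /
boundedly-generated hosts Pratt 2024 Thm 4.7 shows it forces `Val(ℤ_n) ≥ n^{4/3−ε}`, so Pratt's
Conj 4.1 (open) would bar those — and by `CyclicReduction` prime cyclic hosts lose nothing, so
Conj 4.1 would refute the heart outright; route FourierTwoFamiliesModP runs an L²-Fourier
density-increment kill engine against exactly this statement (half-density theorem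
`2ns² ≤ |H|(s+1)` and CommonFrequencyBias already proved there).
Sources: arXiv:math/0511460 Conj. 4.7 (held text Conj. 26), Prop. 4.5–4.6; arXiv:1605.06702 p. 6;
arXiv:2309.03878 Thm 4.7, Conj 4.1, p. 10; tree `Theses/GroupTheoreticSTPP.lean`,
`Theses/FourierTwoFamiliesModP.lean` (CyclicReduction, HalfDensity, WallBreachModP). -/
theorem stub_twoFamilies : CPackingConstruction := by
  sorry

/-! ## Former stub 2 — LANDED (p112559): `Theorems.ThinPackings.stub_packingToCThesis :
CPackingConstruction → CThesis` (CKSU triangle lift `addSimultaneousTPP_of_sdpp` over a corner-free index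
configuration `exists_cornerFree_indexMaps_card_ge`, volumes `card_mul_card_mul_card_sdpp`,
`δ = min ε 1 / 20`, `n^ε > 64`).  Imported above and used by name in `ThinPackings_of`. -/

/-! ## Composition (kernel-checked, no sorry): two families ⟹ X_C ⟹ the crux, by name -/

/-- **CKSU Conj. 4.7 ⟹ `ThinPackings`.**  Hypothesis: the open stub statement by name; the landed glue
`Theorems.ThinPackings.stub_packingToCThesis` (p112559) gives `CThesis`; conclusion: the crux decl by name.  The last step is the `←` direction of the landed costume theorem
`not_thinPackings_iff_not_cThesis` (Negative/ThinPackingsIffCThesis, p76748): a square near-tight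
abelian STPP family is a crux witness at every shape exponent `a < 1`. -/
theorem ThinPackings_of : Stmt.stub_twoFamilies → ThinPackings := by
  intro hTF
  have hC : CThesis := Theorems.ThinPackings.stub_packingToCThesis hTF
  by_contra hT
  exact (not_thinPackings_iff_not_cThesis.mp hT) hC

/-- The skeleton closes the crux modulo the one registered stub (the only `sorry` is `stub_twoFamilies`). -/
theorem ThinPackings_proof : ThinPackings :=
  ThinPackings_of stub_twoFamilies

end Summit.MatrixMultiplication.MatrixMultiplication.Cruxes.ThinPackings.TwoFamiliesSalemSpencer
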